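import Summits.NavierStokesRegularity.NavierStokesRegularity.Theses.AxisymmetricExtremality
import Summits.NavierStokesRegularity.NavierStokesRegularity.Theorems.AxisymmetricSwirlRegularity
import Summits.NavierStokesRegularity.NavierStokesRegularity.Theorems.AxisymmetricExtremalityAxisymmetricKatoGlobalReduction
import Literature.Analysis.FluidPDE.RusinSverakCompactness
import HarnessLib

/-!
# Strategist s16-g8 (independent census, family `s`) — typed attempts for crux
# `AxisymmetricExtremality.AxisymmetricKatoGlobal` (stmt-NavierStokesRegularity-15453)

Scratch file of the census `STRATEGY-CENSUS-s16.md` / `STRATEGY-CENSUS-s16-g8.md`: every heading's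
concrete attempt is TYPED here over existing declarations so that "no leverage" is a statement about
a precise Prop, not about prose.  Nothing here is a line (no `stub_*`, no composition claimed);
nothing is proposed to Theorems.
-/

noncomputable section

open Set MeasureTheory Filter Topology Function Metric
open scoped ENNReal NNReal
open Literature.Analysis.FluidPDE Literature.Analysis.FunctionSpaces

namespace Summit.NavierStokesRegularity.NavierStokesRegularity.Cruxes.AxisymmetricKatoGlobal.StrategistS16G8

set_option linter.unusedVariables false
set_option linter.dupNamespace false

local notation "ℝ³" => EuclideanSpace ℝ (Fin 3)
local notation "ℂ³" => EuclideanSpace ℂ (Fin 3)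

/-! ## H1 — weaker intermediate from the summit side -/

/-- **W-a (threshold instance).** What the route's `closes` actually consumes of the crux: no
Rusin–Šverák `Ḣ^{1/2}`-minimal blow-up datum is axisymmetric. -/
def AxisymMinimalDatumExcluded : Prop :=
  ∀ ν : ℝ, 0 < ν → ∀ (u₀ : ℝ³ → ℝ³) (g : HomSobolev ℝ³ ℂ³ (1 / 2 : ℝ)),
    IsMinimalBlowupDatum ν u₀ g → IsAxisymmetric u₀ → False

/-- The threshold instance is implied by the crux (so it is weaker as a statement). -/
theorem axisymMinimalDatumExcluded_of_crux
    (h : Theses.AxisymmetricExtremality.AxisymmetricKatoGlobal) : AxisymMinimalDatumExcluded := by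
  intro ν hν u₀ g hmin hax
  obtain ⟨h3, hrep, hdiv, _, hnot⟩ := hmin
  exact hnot (h ν hν u₀ g h3 hrep hdiv (fun θ x => hax θ x))

/-- The toroidal (swirl) part `u_θ e_θ = (Γ / r²) (−x₁, x₀, 0)` of a field (junk `0` on the axis
through division by zero). -/
def toroidalPart (u : ℝ³ → ℝ³) (x : ℝ³) : ℝ³ :=
  (swirl u x / (x 0 ^ 2 + x 1 ^ 2)) • (WithLp.toLp 2 ![-(x 1), x 0, 0] : ℝ³)

/-- The poloidal part `u − u_θ e_θ = u_r e_r + u_z e_z`. -/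
def poloidalPart (u : ℝ³ → ℝ³) (x : ℝ³) : ℝ³ := u x - toroidalPart u x

/-- **The missing lever for W-a: persistence of blow-up under swirl reduction.**  If an
axisymmetric critical datum blows up, then so does some datum with the same poloidal part and the
swirl scaled by a factor `c < 1`.  Together with the `Ḣ^{1/2}`-orthogonality of the poloidal /
toroidal parts of an axisymmetric field (so the reduced datum has strictly smaller norm when the
swirl is non-zero) and the landed swirl-free stratum, THIS would prove `AxisymMinimalDatumExcluded`.
Nothing of the kind is in print: there is no comparison / monotonicity principle in the swirl
amplitude for Navier–Stokes (the global set is open in `Ḣ^{1/2}`, Gallagher–Iftimie–Planchon 2003,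
and that is all). -/
def SwirlReductionPersistsBlowup : Prop :=
  ∀ ν : ℝ, 0 < ν → ∀ (u₀ : ℝ³ → ℝ³) (g : HomSobolev ℝ³ ℂ³ (1 / 2 : ℝ)),
    MemLp u₀ 3 volume → g.Represents (EuclideanSpace.complexify ∘ u₀) → IsWeaklyDivFree u₀ →
    IsAxisymmetric u₀ → ¬ HasGlobalKatoSolution ν u₀ →
    ∃ c : ℝ, 0 ≤ c ∧ c < 1 ∧
      ¬ HasGlobalKatoSolution ν (fun x => poloidalPart u₀ x + c • toroidalPart u₀ x)

/-- **W-b (classical leaf + upgrade).** The data-class enlargement Schwartz ↦ `L³ ∩ Ḣ^{1/2}` as a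
separate statement. -/
def ClassicalLeafUpgrade : Prop :=
  Summit.NavierStokesRegularity.NavierStokesRegularity.AxisymmetricSwirlRegularity →
    Theses.AxisymmetricExtremality.AxisymmetricKatoGlobal

/-- The bridge split `leaf ∧ (leaf → crux)`: modus ponens. The hard piece is the leaf. -/
theorem crux_of_leaf_and_upgrade
    (h₁ : Summit.NavierStokesRegularity.NavierStokesRegularity.AxisymmetricSwirlRegularity)
    (h₂ : ClassicalLeafUpgrade) : Theses.AxisymmetricExtremality.AxisymmetricKatoGlobal :=
  h₂ h₁

/-! ## H2 — decomposition: the a-priori swirl modulus IS the crux (machine-checked direction) -/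

/-- The registered residue (lead stub 3, verbatim type). -/
def SwirlAxisModulus : Prop :=
  ∀ ν : ℝ, 0 < ν → ∀ T : ℝ, 0 < T → ∀ (u₀ : ℝ³ → ℝ³)
    (g : HomSobolev ℝ³ ℂ³ (1 / 2 : ℝ)) (u : ℝ → ℝ³ → ℝ³),
    g.Represents (EuclideanSpace.complexify ∘ u₀) →
    IsKatoSolutionOn T ν u₀ u → ContDiffOn ℝ (⊤ : ℕ∞) (uncurry u) (Ioo 0 T ×ˢ univ) →
    (∀ t ∈ Ioo 0 T, IsAxisymmetric (u t)) →
    ∀ t₀ ∈ Ioo 0 T, ∃ C δ₀ : ℝ, 0 < δ₀ ∧ δ₀ < 1 ∧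
      ∀ t ∈ Ico t₀ T, ∀ x : ℝ³, cylRadius x ≤ δ₀ →
        |swirl (u t) x| ≤ C / |Real.log (cylRadius x)| ^ 3

/-- **D-e (regime split by swirl size).** Small-swirl regime in scale-invariant form (Lei–Zhang 2017
= Lemarié-Rieusset 2016 Thm 10.6 asks more: `ω_θ/r, u_θ²/r ∈ L²`, `Γ ∈ L² ∩ L^∞` and a small
PRODUCT).  The bare `‖Γ₀‖_∞ ≤ ε ν` version below is NOT in print (Chen–Fang–Zhang 2017 Thm 1.2 needs
`d < 1`, i.e. excludes the `L^∞` endpoint of `r^d u_θ`). -/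
def SmallSwirlGlobal : Prop :=
  ∃ ε : ℝ, 0 < ε ∧ ∀ ν : ℝ, 0 < ν → ∀ (u₀ : ℝ³ → ℝ³) (g : HomSobolev ℝ³ ℂ³ (1 / 2 : ℝ)),
    MemLp u₀ 3 volume → g.Represents (EuclideanSpace.complexify ∘ u₀) → IsWeaklyDivFree u₀ →
    IsAxisymmetric u₀ → (∀ x, |swirl u₀ x| ≤ ε * ν) → HasGlobalKatoSolution ν u₀

/-- Large-swirl complement; `SmallSwirlGlobal ∧ LargeSwirlGlobal → crux` is a case split, and the
second case is the crux minus an (itself unproved) perturbative regime. -/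
def LargeSwirlGlobal (ε : ℝ) : Prop :=
  ∀ ν : ℝ, 0 < ν → ∀ (u₀ : ℝ³ → ℝ³) (g : HomSobolev ℝ³ ℂ³ (1 / 2 : ℝ)),
    MemLp u₀ 3 volume → g.Represents (EuclideanSpace.complexify ∘ u₀) → IsWeaklyDivFree u₀ →
    IsAxisymmetric u₀ → (∃ x, ε * ν < |swirl u₀ x|) → HasGlobalKatoSolution ν u₀

theorem crux_of_swirl_regimes {ε : ℝ}
    (hs : ∀ ν : ℝ, 0 < ν → ∀ (u₀ : ℝ³ → ℝ³) (g : HomSobolev ℝ³ ℂ³ (1 / 2 : ℝ)),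
      MemLp u₀ 3 volume → g.Represents (EuclideanSpace.complexify ∘ u₀) → IsWeaklyDivFree u₀ →
      IsAxisymmetric u₀ → (∀ x, |swirl u₀ x| ≤ ε * ν) → HasGlobalKatoSolution ν u₀)
    (hl : LargeSwirlGlobal ε) : Theses.AxisymmetricExtremality.AxisymmetricKatoGlobal := by
  intro ν hν u₀ g h3 hrep hdiv hax
  by_cases hsm : ∀ x, |swirl u₀ x| ≤ ε * ν
  · exact hs ν hν u₀ g h3 hrep hdiv (fun θ x => hax θ x) hsm
  · simp only [not_forall, not_le] at hsm
    exact hl ν hν u₀ g h3 hrep hdiv (fun θ x => hax θ x) hsm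

/-! ## H3 — transfer: the one-sided radial inflow lever (sibling crux `AxisymSwirlRegular`,
KNSS 2009 Thm 5.3 two-sided; ideas `sink-vortex-barrier`, `bessel-zero-absorbing-axis`) -/

/-- A-priori one-sided inflow bound near the axis for axisymmetric Kato solutions:
`r u_r = x₀u₀ + x₁u₁ ≥ −C ν` on `{r ≤ δ} × [t₀, T)`.  With `C < 2` the swirl modulus follows
(ideas of 2026-08-17); for `C ≥ 2` the criterion itself is open (KNSS conjecture, axisymmetric
case).  Typed to show where the transfer breaks: nothing bounds `C`. -/
def AprioriInflowBound : Prop :=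
  ∀ ν : ℝ, 0 < ν → ∀ T : ℝ, 0 < T → ∀ (u₀ : ℝ³ → ℝ³)
    (g : HomSobolev ℝ³ ℂ³ (1 / 2 : ℝ)) (u : ℝ → ℝ³ → ℝ³),
    g.Represents (EuclideanSpace.complexify ∘ u₀) →
    IsKatoSolutionOn T ν u₀ u → ContDiffOn ℝ (⊤ : ℕ∞) (uncurry u) (Ioo 0 T ×ˢ univ) →
    (∀ t ∈ Ioo 0 T, IsAxisymmetric (u t)) →
    ∀ t₀ ∈ Ioo 0 T, ∃ C δ : ℝ, 0 < δ ∧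
      ∀ t ∈ Ico t₀ T, ∀ x : ℝ³, cylRadius x ≤ δ → -(C * ν) ≤ x 0 * u t x 0 + x 1 * u t x 1

/-! ## H4 — strengthen: the quantitative form -/

/-- **S⁺ (quantitative axisymmetric Kato bound).** A bound on `√t ‖u(t)‖_∞` depending only on
`ν` and `‖u₀‖_{Ḣ^{1/2}}`; implies the crux by Kato continuation, and is implied by it only through a
compactness argument in the axisymmetric class that is not in print for infinite-energy data
(Tao 2013 Thm 1.20 is stated in the `H¹` category).  The added rigidity buys nothing at the axis:
the only a-priori critical quantity is still `‖Γ‖_∞`. -/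
def QuantAxisymKato : Prop :=
  ∃ F : ℝ → ℝ≥0∞ → ℝ, ∀ ν : ℝ, 0 < ν → ∀ T : ℝ, 0 < T → ∀ (u₀ : ℝ³ → ℝ³)
    (g : HomSobolev ℝ³ ℂ³ (1 / 2 : ℝ)) (u : ℝ → ℝ³ → ℝ³),
    g.Represents (EuclideanSpace.complexify ∘ u₀) → IsWeaklyDivFree u₀ → IsAxisymmetric u₀ →
    IsKatoSolutionOn T ν u₀ u →
    ∀ t ∈ Ioo 0 T, ∀ x : ℝ³, Real.sqrt t * ‖u t x‖ ≤ F ν ‖g‖ₑ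

/-! ## H5 — negation: the counterexample statement -/

/-- An axisymmetric critical blow-up datum (Hou's two-scale tornado would be one). -/
def AxisymKatoBlowupDatum : Prop :=
  ∃ ν : ℝ, 0 < ν ∧ ∃ (u₀ : ℝ³ → ℝ³) (g : HomSobolev ℝ³ ℂ³ (1 / 2 : ℝ)),
    MemLp u₀ 3 volume ∧ g.Represents (EuclideanSpace.complexify ∘ u₀) ∧ IsWeaklyDivFree u₀ ∧
    IsAxisymmetric u₀ ∧ ¬ HasGlobalKatoSolution ν u₀

theorem axisymKatoBlowupDatum_iff_not_crux :
    AxisymKatoBlowupDatum ↔ ¬ Theses.AxisymmetricExtremality.AxisymmetricKatoGlobal := by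
  constructor
  · rintro ⟨ν, hν, u₀, g, h3, hrep, hdiv, hax, hnot⟩ h
    exact hnot (h ν hν u₀ g h3 hrep hdiv (fun θ x => hax θ x))
  · intro h
    by_contra hne
    apply h
    intro ν hν u₀ g h3 hrep hdiv hax
    by_contra hng
    exact hne ⟨ν, hν, u₀, g, h3, hrep, hdiv, (fun θ x => hax θ x), hng⟩

end Summit.NavierStokesRegularity.NavierStokesRegularity.Cruxes.AxisymmetricKatoGlobal.StrategistS16G8

end
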